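import Summits.QuantumFields.YangMills.Theorems.UnitScaleTiltProp7CurrentSlaving
import Summits.QuantumFields.YangMills.Theorems.UnitScaleTiltProp7CurrentSlavingLocalFlat
import HarnessLib

/-!
# Route `UnitScaleTilt`, crux K1 child «MinimiserStabilityRegPr» (stmt-QuantumFields-19200), registered stub `stub_prop7From14` (V3, skeleton v7
# cc37a1787726) — lane B: **THE CURRENT IS SLAVED TO THE CURVATURE UNDER THE E–L PORT, LOCAL FORM** — the presentation (`‖V − 1‖ ≤ a`) and the port
# defect are needed only on a tube of `2R + 2` blocks along the bond's axis, never a global gauge: `|c²ℓ((D^{1*}_V∂V)(e))| ≤ 12c²f(c⁻¹ + a) + 4p +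
# 2^{−(R+1)}·A_g` at the d = 3 carrier

Cell `ym3-torus` ∕ fleet seat `ym-ust-19200-p3` (WIDTH-LEVER lane B of V3; HUMAN RULING D-0037, YM ladder rung R3).  `--supports stmt-QuantumFields-19200
--as helper`.  Sequel of `UnitScaleTiltProp7CurrentSlaving` (p545507, global form) and `UnitScaleTiltProp7CurrentSlavingLocalFlat` (maximum principle).

WHY.  A configuration of print's space (6) ([Balaban1985Variational] p. 278) has small plaquette variables everywhere but NO global near-identity
presentation (holonomies along the torus cycles); the global slaving estimate of the prequel asks for one.  Here everything is localised along the axis of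
the bond `e`: the tent–Stokes bound reads the transverse bonds of the tube of each coarse bond only (§5), and the diagonally dominant tridiagonal normal
operator gives the coarse data at `e`'s two coarse bonds from the `2R + 2` axis neighbours up to a tail `2^{−(R+1)}` times a global a-priori bound (prequel
§4).  A transverse-first axial gauge of the tube has `a ≤ 2(L^k + 2)·f` with no drift along the axis, so with `f = ε₀L^{−2k}`, `R ≈ k·log₂L` the bound is
print's scaling `O(ε₀L^{−3k})` of the second member of (2) — chart-free, Green's-function-free, uniform in `k` and in the volume.

WHAT IS PROVED (sorry-free, no definition, standard axioms):
* §5 **`abs_bondAvgIter_covDivT_le_local`** (every torus of `Setup`, units-valued `V` with `‖V(b)⁻¹‖ ≤ 1`, global plaquette bound `f`, presentation bound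
  `a` only on the transverse bonds at the tube of `c`): `|Q_k(ℓ∘D^{1*}_V∂V)(c)| ≤ (d − 1)·Λ·f·(2(L^k)⁻¹ + 2a)`.
* §6 **`abs_current_le_of_multiplier_T3_local`** (d = 3 carrier of `T3Thm1Carrier.varProblem3 F n K`, port currency of
  `Prop7FlatSliceRegularityGauge.exists_repr_abs_le_of_multiplier_T3`): unitary-valued `V`, `‖ℓ‖ ≤ 1`, coarse bond of `e` = `⟨x₀ + (R+2)e_μ, μ⟩`, presentation
  `≤ a` and defect `≤ p` on the tubes of `⟨x₀ + s·e_μ, μ⟩`, `1 ≤ s ≤ 2R + 2` (and the defect at `e`), `|(Q*ω)| ≤ A_g` globally ⇒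
  `|c²ℓ((D^{1*}_V∂V)(e))| ≤ 12c²f(c⁻¹ + a) + 4p + 2^{−(R+1)}A_g`, `c = L^{K−n}`.
HONEST SCOPE.  A-priori estimate in the currency of the Euler–Lagrange PORT; does not improve the plaquette member; nothing of Bałaban's nonlinear analysis is
asserted; not a claim about the mass gap.

References: T. Bałaban, CMP **102** (1985) 277–309 [Balaban1985Variational] ((2) p.278, (127) p.297, (133) p.298, (158) p.302); CMP **99** (1985) 75–102
[Balaban1985RegularSpaces] ((1.1)–(1.2) p.76); CMP **95** (1984) 17–40 [Balaban1984PropagatorsI] ((1.18) p.20).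
-/

set_option autoImplicit false

noncomputable section

open scoped BigOperators

namespace Summit.QuantumFields.YangMills.Theorems.Prop7CurrentSlaving

open Literature.MathematicalPhysics.QuantumFieldTheory.Balaban1983to89
open Finset LatticeFieldCalculus B1RG242Torus
open Summit.QuantumFields.YangMills.Theorems.Prop7FlatCoercivity (iterate_shift_eq_runSite runSite_runSite runSite_apply_self
  runSite_apply_of_ne fibreSite_runSite sum_fibre_eq_sum_offsets bondAvgIter_eq_lineBlockAvg_real sitesPerDir_zero_eq_pow_mul)
open Summit.QuantumFields.YangMills.Theorems.Prop7LineAvgRightInverse (sum_offsets_eq_sum_split card_offsets_reset fibreSite_update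
  lineAvg_adjField adjField_abs_le tridiag_pointwise key_dominance tent_gamma_nonneg tent_moments_sub cast_tent)
open Summit.QuantumFields.YangMills.Theorems.Prop7LineAvgAdjoint (abs_le_pow_mul_of_adjField_abs_le)

variable {P : Params}

/-! ## §5 The tube-local covariant bound -/

section CovariantLocal

variable {k : ℕ} {𝔸 : Type*} [NormedRing 𝔸] [NormedAlgebra ℂ 𝔸]

open B10Eq68TorusRegularity (plaqFT covDerivT covDivT)

/-- **TUBE-LOCAL FORM OF THE COVARIANT TENT–STOKES BOUND**: as `abs_bondAvgIter_covDivT_le`, but the presentation hypothesis `‖V(b) − 1‖ ≤ a` is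
required only on the TRANSVERSE bonds `⟨x − e_ν, ν⟩`, `ν ≠ μ`, at the `L^{k(d+1)}` bond visits `x` of the tube of `c` (a slice-wise axial
gauge supplies it with `a ≤ 2(L^k + 1)·f`, no drift along the axis) (the plaquette bound `f` stays global, as in
print's space (6)). [cite: Balaban1985RegularSpaces, (1.1)-(1.2) p.76; Balaban1984PropagatorsI, (1.18) p.20] -/
theorem abs_bondAvgIter_covDivT_le_local (hk : k ≤ P.m + P.K) (V : GaugeField P 0 𝔸ˣ) (c : PBond P k) {a f Λ : ℝ} (hΛ : 0 ≤ Λ)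
    (hVinv : ∀ b, ‖(((V b)⁻¹ : 𝔸ˣ) : 𝔸)‖ ≤ 1)
    (haV : ∀ (r : Fin P.d → Fin (P.L ^ k)) (t : ℕ) (ν : Fin P.d), ν ≠ c.dir → t < P.L ^ k →
      ‖(V ⟨(runSite (Site.fibreSite 0 k c.src r) c.dir t).unshift ν, ν⟩ : 𝔸) - 1‖ ≤ a)
    (hfV : ∀ (x : Site P 0) (κ μ : Fin P.d), ‖plaqFT V κ μ x - 1‖ ≤ f)
    (ℓ : 𝔸 →+ ℝ) (hℓ : ∀ Y, |ℓ Y| ≤ Λ * ‖Y‖) :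
    |bondAvgIter k (fun b : PBond P 0 => ℓ (covDivT 1 V b.dir b.src)) c| ≤ ((P.d : ℝ) - 1) * Λ * f * (2 * ((P.L : ℝ) ^ k)⁻¹ + 2 * a) := by
  set μ : Fin P.d := c.dir with hμ
  set g : Fin P.d → Site P 0 → ℝ := fun ν x => if ν < μ then ℓ (plaqFT V ν μ x - 1) else -ℓ (plaqFT V μ ν x - 1) with hg
  have hG : ∀ ν x, |g ν x| ≤ Λ * f := by
    intro ν x
    simp only [hg]
    split_ifs
    · exact (hℓ _).trans (mul_le_mul_of_nonneg_left (hfV _ _ _) hΛ)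
    · rw [abs_neg]; exact (hℓ _).trans (mul_le_mul_of_nonneg_left (hfV _ _ _) hΛ)
  -- the per-direction conjugation defects at a tube point `x`
  have hdef : ∀ (ν : Fin P.d) (G : Site P 0 → 𝔸) (x : Site P 0), ‖(V ⟨x.unshift ν, ν⟩ : 𝔸) - 1‖ ≤ a → (∀ z, ‖G z - 1‖ ≤ f) →
      |ℓ (covDerivT 1 V ν G x) - (ℓ (G (x.unshift ν) - 1) - ℓ (G x - 1))| ≤ Λ * (2 * a * f) := by
    intro ν G x hax hGf
    refine (abs_covDerivT_sub_diff_le V ν G x (hVinv _) ℓ hΛ hℓ).trans (mul_le_mul_of_nonneg_left ?_ hΛ)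
    have h2 := hGf (x.unshift ν)
    nlinarith [norm_nonneg ((V ⟨x.unshift ν, ν⟩ : 𝔸) - 1), norm_nonneg (G (x.unshift ν) - 1)]
  have hX : ∀ (r : Fin P.d → Fin (P.L ^ k)) (t : ℕ), t < P.L ^ k →
      |ℓ (covDivT 1 V μ (runSite (Site.fibreSite 0 k c.src r) μ t))
        - ∑ ν ∈ (Finset.univ : Finset (Fin P.d)).erase μ,
          (g ν ((runSite (Site.fibreSite 0 k c.src r) μ t).unshift ν) - g ν (runSite (Site.fibreSite 0 k c.src r) μ t))|
      ≤ ((P.d : ℝ) - 1) * (Λ * (2 * a * f)) := by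
    intro r t ht
    set x : Site P 0 := runSite (Site.fibreSite 0 k c.src r) μ t with hx
    have hcov : ℓ (covDivT 1 V μ x) = ∑ ν ∈ Finset.Iio μ, ℓ (covDerivT 1 V ν (plaqFT V ν μ) x)
        - ∑ ν ∈ Finset.Ioi μ, ℓ (covDerivT 1 V ν (plaqFT V μ ν) x) := by
      rw [covDivT, map_sub, map_sum, map_sum]
    have hsplit : ∑ ν ∈ (Finset.univ : Finset (Fin P.d)).erase μ, (g ν (x.unshift ν) - g ν x)
        = ∑ ν ∈ Finset.Iio μ, (ℓ (plaqFT V ν μ (x.unshift ν) - 1) - ℓ (plaqFT V ν μ x - 1))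
          - ∑ ν ∈ Finset.Ioi μ, (ℓ (plaqFT V μ ν (x.unshift ν) - 1) - ℓ (plaqFT V μ ν x - 1)) := by
      rw [erase_eq_Iio_union_Ioi, Finset.sum_union (disjoint_Iio_Ioi μ), sub_eq_add_neg, ← Finset.sum_neg_distrib]
      congr 1
      · refine Finset.sum_congr rfl fun ν hν => ?_
        rw [Finset.mem_Iio] at hν
        simp only [hg, if_pos hν]
      · refine Finset.sum_congr rfl fun ν hν => ?_
        rw [Finset.mem_Ioi] at hν
        simp only [hg, if_neg (lt_asymm hν)]
        ring
    rw [hcov, hsplit]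
    have e : ∑ ν ∈ Finset.Iio μ, ℓ (covDerivT 1 V ν (plaqFT V ν μ) x) - ∑ ν ∈ Finset.Ioi μ, ℓ (covDerivT 1 V ν (plaqFT V μ ν) x)
        - (∑ ν ∈ Finset.Iio μ, (ℓ (plaqFT V ν μ (x.unshift ν) - 1) - ℓ (plaqFT V ν μ x - 1))
          - ∑ ν ∈ Finset.Ioi μ, (ℓ (plaqFT V μ ν (x.unshift ν) - 1) - ℓ (plaqFT V μ ν x - 1)))
        = ∑ ν ∈ Finset.Iio μ, (ℓ (covDerivT 1 V ν (plaqFT V ν μ) x) - (ℓ (plaqFT V ν μ (x.unshift ν) - 1) - ℓ (plaqFT V ν μ x - 1)))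
          - ∑ ν ∈ Finset.Ioi μ, (ℓ (covDerivT 1 V ν (plaqFT V μ ν) x) - (ℓ (plaqFT V μ ν (x.unshift ν) - 1) - ℓ (plaqFT V μ ν x - 1))) := by
      simp only [Finset.sum_sub_distrib]
      ring
    rw [e]
    refine (abs_sub _ _).trans ?_
    refine (add_le_add
      ((Finset.abs_sum_le_sum_abs _ _).trans (Finset.sum_le_sum fun ν hν =>
        hdef ν _ x (haV r t ν (ne_of_lt (Finset.mem_Iio.1 hν)) ht) (fun z => hfV z ν μ)))
      ((Finset.abs_sum_le_sum_abs _ _).trans (Finset.sum_le_sum fun ν hν =>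
        hdef ν _ x (haV r t ν (ne_of_gt (Finset.mem_Ioi.1 hν)) ht) (fun z => hfV z μ ν)))).trans ?_
    rw [Finset.sum_const, Finset.sum_const, nsmul_eq_mul, nsmul_eq_mul, ← add_mul, card_Iio_add_card_Ioi μ]
  have hmain := abs_bondAvgIter_le_of_transverseDiff_local hk (fun b : PBond P 0 => ℓ (covDivT 1 V b.dir b.src)) c
    ((Finset.univ : Finset (Fin P.d)).erase μ) g hG hX
  have hcard : ((((Finset.univ : Finset (Fin P.d)).erase μ).card : ℕ) : ℝ) = (P.d : ℝ) - 1 := by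
    rw [Finset.card_erase_of_mem (Finset.mem_univ _), Finset.card_univ, Fintype.card_fin, Nat.cast_sub P.hd]
    push_cast
    ring
  rw [hcard] at hmain
  refine hmain.trans (le_of_eq ?_)
  ring

end CovariantLocal

/-! ## §6 At the d = 3 carrier: the LOCAL slaving estimate in the port currency -/

section CarrierLocal

open scoped Matrix.Norms.L2Operator
open T3ContinuumYM3Torus (T3Family)
open Summit.QuantumFields.YangMills.Theorems.Prop7FlatCoercivityR (succ_le_T3)
open B6SectAOperatorsV1 B6SectCTwoScaleV1 B6GOneLevelV1Bridge
open B10Eq68TorusRegularity (plaqFT covDivT)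
open B10Eq27TorusAxialLog (U1_of_unitaryUnits)
open B7Prop1Explicit (mem_U1)
open B7Prop2Explicit (unitaryUnits)

/-- **THE CURRENT IS SLAVED TO THE CURVATURE UNDER THE E–L PORT — LOCAL FORM, d = 3 CARRIER** (`T3Thm1Carrier.varProblem3 F n K`, `k = K − n`,
`c = L^{K−n}`).  Let `V` be unitary-valued with all plaquette variables within `f` of `1` (print's (6), first member, global), `e` a fine bond whose
coarse bond is `⟨x₀ + (R+2)e_μ, μ⟩`, and suppose ONLY NEAR `e` — on the tubes of the `2R + 2` coarse bonds `⟨x₀ + s·e_μ, μ⟩`, `1 ≤ s ≤ 2R + 2` — that the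
presentation is near the identity on the transverse bonds (`‖V − 1‖ ≤ a`; a transverse-first axial gauge of the tube has `a ≤ 2(L^k + 2)f`) and that the
E–L ∕ port defect of the component `ℓ` (`‖ℓ‖ ≤ 1`) against SOME coarse `ω` is `≤ p` (also at `e` itself); globally only `|(Q*ω)(b)| ≤ A_g`.  Then
`|c²ℓ((D^{1*}_V∂V)(e))| ≤ 12c²f(c⁻¹ + a) + 4p + 2^{−(R+1)}A_g` — no global gauge, no Green's function, uniform in `k`, `m`, `n`, `K` and the volume.
[cite: Balaban1985Variational, (2) p.278, (127) p.297, (133) p.298, (158) p.302] -/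
theorem abs_current_le_of_multiplier_T3_local (F : T3Family) (n K : ℕ)
    (V : GaugeField (F.P K) 0 (Matrix (Fin 2) (Fin 2) ℂ)ˣ) (hV : ∀ b, V b ∈ unitaryUnits (Matrix (Fin 2) (Fin 2) ℂ))
    {f : ℝ} (hfV : ∀ (s : Site (F.P K) 0) (κ μ : Fin 3), ‖plaqFT V κ μ s - 1‖ ≤ f)
    (ℓ : Matrix (Fin 2) (Fin 2) ℂ →L[ℝ] ℝ) (hℓ : ‖ℓ‖ ≤ 1)
    (e : PBond (F.P K) 0) (x₀ : Site (F.P K) (K - n)) (R : ℕ) (he : Site.proj (K - n) (K - n) e.src = runSite x₀ e.dir (R + 2))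
    {a : ℝ} (haV : ∀ (s : ℕ), 1 ≤ s → s ≤ 2 * R + 2 → ∀ (r : Fin 3 → Fin (F.L ^ (K - n))) (t : ℕ) (ν : Fin 3), ν ≠ e.dir →
      t < F.L ^ (K - n) →
      ‖(V ⟨(runSite (Site.fibreSite 0 (K - n) (runSite x₀ e.dir s) r) e.dir t).unshift ν, ν⟩ : Matrix (Fin 2) (Fin 2) ℂ) - 1‖ ≤ a)
    (ω : BondIdxSpace (twoScale (K - n) (succ_le_T3 F n K) (∅ : Finset (Site (F.P K) (K - n + 1))))) {p Ag : ℝ}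
    (hωe : |((F.L : ℝ) ^ (K - n)) ^ 2 * ℓ (covDivT 1 V e.dir e.src)
      - QsE (twoScale (K - n) (succ_le_T3 F n K) (∅ : Finset (Site (F.P K) (K - n + 1)))) ω e| ≤ p)
    (hωnear : ∀ (s : ℕ), 1 ≤ s → s ≤ 2 * R + 2 → ∀ (r : Fin 3 → Fin (F.L ^ (K - n))) (t : ℕ), t < F.L ^ (K - n) →
      |((F.L : ℝ) ^ (K - n)) ^ 2 * ℓ (covDivT 1 V e.dir (runSite (Site.fibreSite 0 (K - n) (runSite x₀ e.dir s) r) e.dir t))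
        - QsE (twoScale (K - n) (succ_le_T3 F n K) (∅ : Finset (Site (F.P K) (K - n + 1)))) ω
            ⟨runSite (Site.fibreSite 0 (K - n) (runSite x₀ e.dir s) r) e.dir t, e.dir⟩| ≤ p)
    (hAg : ∀ b : PBond (F.P K) 0, |QsE (twoScale (K - n) (succ_le_T3 F n K) (∅ : Finset (Site (F.P K) (K - n + 1)))) ω b| ≤ Ag) :
    |((F.L : ℝ) ^ (K - n)) ^ 2 * ℓ (covDivT 1 V e.dir e.src)|
      ≤ 12 * ((F.L : ℝ) ^ (K - n)) ^ 2 * f * (((F.L : ℝ) ^ (K - n))⁻¹ + a) + 4 * p + (1 / 2) ^ (R + 1) * Ag := by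
  set c : ℝ := (F.L : ℝ) ^ (K - n) with hc
  have hk : K - n ≤ (F.P K).m + (F.P K).K := Nat.le_of_succ_le (succ_le_T3 F n K)
  have hc0 : 0 < c := pow_pos (Nat.cast_pos.2 (F.P K).L_pos) _
  -- the scaled component as an additive map with `|ℓ′(Y)| ≤ c²‖Y‖`
  set ℓ' : Matrix (Fin 2) (Fin 2) ℂ →+ ℝ := (c ^ 2 • ℓ).toLinearMap.toAddMonoidHom with hℓ'
  have hℓ'apply : ∀ Y, ℓ' Y = c ^ 2 * ℓ Y := fun Y => rfl
  have hℓ'bd : ∀ Y, |ℓ' Y| ≤ c ^ 2 * ‖Y‖ := by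
    intro Y
    rw [hℓ'apply, abs_mul, abs_of_nonneg (by positivity : (0 : ℝ) ≤ c ^ 2)]
    refine mul_le_mul_of_nonneg_left ?_ (by positivity)
    have h1 : |ℓ Y| ≤ ‖ℓ‖ * ‖Y‖ := by rw [← Real.norm_eq_abs]; exact ℓ.le_opNorm Y
    nlinarith [norm_nonneg Y]
  have hVinv : ∀ b, ‖(((V b)⁻¹ : (Matrix (Fin 2) (Fin 2) ℂ)ˣ) : Matrix (Fin 2) (Fin 2) ℂ)‖ ≤ 1 := by
    letI : CStarAlgebra (Matrix (Fin 2) (Fin 2) ℂ) := B10Eq29TubeLine.cstarAlgebraMatrix 2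
    intro b
    exact (mem_U1.1 (U1_of_unitaryUnits hV b)).2
  have hd : ((F.P K).d : ℝ) = 3 := by norm_num [show (F.P K).d = 3 from rfl]
  -- the near block averages of the scaled component of the current
  have hM : ∀ (s : ℕ), 1 ≤ s → s ≤ 2 * R + 2 →
      |bondAvgIter (K - n) (fun b : PBond (F.P K) 0 => ℓ' (covDivT 1 V b.dir b.src)) ⟨runSite x₀ e.dir s, e.dir⟩| ≤ 4 * c ^ 2 * f * (c⁻¹ + a) := by
    intro s hs1 hs2
    have h := abs_bondAvgIter_covDivT_le_local hk V ⟨runSite x₀ e.dir s, e.dir⟩ (by positivity : (0 : ℝ) ≤ c ^ 2) hVinv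
      (fun r t ν hν ht => haV s hs1 hs2 r t ν hν ht) hfV ℓ' hℓ'bd
    have hPL : (((F.P K).L : ℝ) ^ (K - n))⁻¹ = c⁻¹ := rfl
    rw [hd, hPL] at h
    refine h.trans (le_of_eq ?_)
    ring
  -- the port defect in tent-field form
  set W : PBond (F.P K) (K - n) → ℝ := fun c' => ω (bondIdxOfEmpty (succ_le_T3 F n K) c') with hW
  set A : PBond (F.P K) 0 → ℝ := fun b => (((F.L : ℝ) ^ (K - n)) ^ (F.P K).d * (F.L : ℝ) ^ (K - n))⁻¹ *
        (((((b.src b.dir).val % F.L ^ (K - n) : ℕ) : ℝ) + 1) * W ⟨Site.proj (K - n) (K - n) b.src, b.dir⟩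
          + ((F.L ^ (K - n) - 1 - (b.src b.dir).val % F.L ^ (K - n) : ℕ) : ℝ) * W ⟨(Site.proj (K - n) (K - n) b.src).unshift b.dir, b.dir⟩)
    with hAdef
  have hA : ∀ b : PBond (F.P K) 0, A b = ((((F.P K).L : ℝ) ^ (K - n)) ^ (F.P K).d * ((F.P K).L : ℝ) ^ (K - n))⁻¹ *
        (((((b.src b.dir).val % (F.P K).L ^ (K - n) : ℕ) : ℝ) + 1) * W ⟨Site.proj (K - n) (K - n) b.src, b.dir⟩
          + (((F.P K).L ^ (K - n) - 1 - (b.src b.dir).val % (F.P K).L ^ (K - n) : ℕ) : ℝ)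
            * W ⟨(Site.proj (K - n) (K - n) b.src).unshift b.dir, b.dir⟩) := fun b => rfl
  have hQs : ∀ b : PBond (F.P K) 0, QsE (twoScale (K - n) (succ_le_T3 F n K) (∅ : Finset (Site (F.P K) (K - n + 1)))) ω b = A b :=
    fun b => QsE_twoScale_empty_apply (succ_le_T3 F n K) ω b
  have hjb : |ℓ' (covDivT 1 V e.dir e.src) - A e| ≤ p := by rw [hℓ'apply, ← hQs e]; exact hωe
  have hjA : ∀ (s : ℕ), 1 ≤ s → s ≤ 2 * R + 2 → ∀ (r : Fin (F.P K).d → Fin ((F.P K).L ^ (K - n))) (t : ℕ), t < (F.P K).L ^ (K - n) →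
      |ℓ' (covDivT 1 V e.dir (runSite (Site.fibreSite 0 (K - n) (runSite x₀ e.dir s) r) e.dir t))
        - A ⟨runSite (Site.fibreSite 0 (K - n) (runSite x₀ e.dir s) r) e.dir t, e.dir⟩| ≤ p := by
    intro s hs1 hs2 r t ht
    rw [hℓ'apply, ← hQs]
    exact hωnear s hs1 hs2 r t ht
  have hAg' : ∀ b : PBond (F.P K) 0, |A b| ≤ Ag := fun b => by rw [← hQs b]; exact hAg b
  have h := abs_le_of_sub_adjField_le_local hk W A hA (fun b : PBond (F.P K) 0 => ℓ' (covDivT 1 V b.dir b.src)) e x₀ R he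
    hjb hjA hM hAg'
  rw [hℓ'apply] at h
  refine h.trans (le_of_eq ?_)
  ring

end CarrierLocal

end Summit.QuantumFields.YangMills.Theorems.Prop7CurrentSlaving

end
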